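import Summits.ABC.IUTFork.Joshi.TestRealHonestPacketDH
import Summits.ABC.IUTFork.Joshi.TestPinsInhabitation
import Summits.ABC.IUTFork.Thm311RealIsmDHMoverCriterion
import Summits.ABC.IUTFork.Thm311RealIsmDHMoverAssembled
import HarnessLib

/-!
# Branch E TEST vs S — the (hρ)-equivariant pin at the honest real setting over the Dupuy–Hilado (Ind2), FREE-PRIME form:
# AT EVERY LABEL `j ∈ 𝔽_l^⋇`, over a prime carrying NO bad place, a star-trivial (Ind2)-generator MOVES the `q`-image
# (abc-iut-E-t41; hand item (a′) of abc-iut-E-cx-2, the «ramified FREE packets» prediction)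

Companion of `Joshi/TestRealPinsEquivariance.lean` (p445387: `∀ ρ qK, ¬ PinnedRegions` at `honestSetting` over (`stripAutDH`, `ismDH`)
from a ZERO-LABEL mover). That witness exploits the label `j = 0`, never read by Cor. 3.12; THIS file gives the LABEL-ROBUST witness
abc-iut-E-cx-2 predicted (11:48:53Z, «the obstruction lives exactly at ramified places over primes with free components»): let `p₀` be a
rational prime with NO bad place above it (`hfree`) and `v₀ | p₀` TAMELY RAMIFIED (`p₀ > 2`, `2 ≤ e(v₀|p₀) ≤ p₀ − 2`). Then, PROOF-ONLY:

* `exists_ind2_starTrivial_moves_qRegion` — for EVERY label `j` there is an (Ind2)-GENERATOR `Φ₀` of the Dupuy–Hilado real shells which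
  acts TRIVIALLY on every star packet (those live over BAD places; `Φ₀` = «in tensor slot `0`, `⊕_v g_v` with `g_{v₀} := g` a tame MOVER of
  `𝒪_{v₀}` (abc-iut-w5-d216 `exists_mem_ismDH_image_closedBall_ne_of_tame`), identity at `v ≠ v₀`; identity in the other slots») and yet does
  NOT map the `q`-image `e⁻¹(𝒪_L)` of `honestSetting` at the packet `(j, p₀)` onto itself: on the pure tensors `z ⊗ u₁ ⊗ ⋯ ⊗ u₁`
  (`z ∈ K_{v₀}` in slot `0` at `v₀`, `u₁ := φ_{v₀}⁻¹(1)`, all other components `0`) membership reads `‖z‖ ≤ 1` — the factor embeddings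
  `σ_{a,i}` are isometric and `‖ψ(⊗_a h_a)_i‖ = ∏_a ‖h_a‖` (`psi_purePacket_apply`, `norm_factorEmb`) — and `Φ₀` acts by `z ↦ g z`.
* `not_pinnedRegions_honestSetting_DH_free` — hence `∀ ρ qK, ¬ PinnedRegions` there (p441977's stabiliser criterion), by a witness at
  ANY prescribed label `j` (e.g. `j = 1 ∈ 𝔽_l^⋇`): the refutation SURVIVES the repairs «(hρ) only at labels in 𝔽_l^⋇» and «`univ` boxes at
  `j = 0`»; it does NOT survive «(Ind2) = isometries» (EL-079) or «regions up to holomorphic hull», nor does it say anything when every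
  ramified place of `F` lies under a bad place (E-cx-2's POS case).

HONEST READING (located, not adjudicated): a statement about OUR typing — `Cor312Vol.ThetaPinned`.1 (equivariance under the FULL closure on
raw regions) ∧ Dupuy–Hilado's `Real.ismDH` (all bicontinuous `φ` with `φ(I_v) = I_v`) ∧ `𝒪_L`-shaped pilot boxes at a ramified free packet.
**No side is taken** on [IUTchIII] Cor. 3.12 or on any author (Mochizuki / Scholze–Stix / Joshi / Dupuy–Hilado); typed ≠ proved ≠ endorsed.
[claim: Mochizuki2012, status: disputed] [cite: DupuyHilado2025, §4.9] [cite: WeilBNT1967, Ch. II §2, Th. 2] [cite: NeukirchANT1999,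
Ch. II Prop. (5.5)]. Standard axioms only; no `sorry`; R14: `Joshi/Test*`.
-/

noncomputable section

open Metric Set Function NumberField IsDedekindDomain
open scoped Pointwise

namespace Summit.ABC.IUTFork.Joshi

open Thm311 Thm311.Real Cor312 Cor312Vol Literature.IUT.LogThetaLattice Literature.IUT.LogVolume
open Literature.NumberTheory.NumberFields Literature.NumberTheory.GaloisRepresentations.Ultrametric

section Free

variable {F : Type} [Field F] [NumberField F] (X : PilotData F) {logv : PadicLogs F} (hlog : LogvAnalytic logv)
  (M : Type) [Field M] [NumberField M]
  (archPk : ∀ (j : (thetaIndex X).Label) (vQ : (thetaIndex X).VQ), Set ((logShellsDH X logv).Packet j vQ))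
  (archSub : ∀ (j : (thetaIndex X).Label) (v : (thetaIndex X).V), Set ((logShellsDH X logv).Packet j ((thetaIndex X).over v)))
  (Ψ : ℤ → ∀ v : (thetaIndex X).V, v ∈ (thetaIndex X).Vbad → Set ((logShellsDH X logv).StarPacket v))
  (act : ℤ → ∀ v : (thetaIndex X).V, v ∈ (thetaIndex X).Vbad →
    (logShellsDH X logv).StarPacket v → Module.End ℚ ((logShellsDH X logv).StarPacket v))
  (Mmod : ℤ → ∀ j : (thetaIndex X).LabelStar, Set ((logShellsDH X logv).GlobalPacket j.1))
  (region : ℤ → ∀ j : (thetaIndex X).LabelStar, FinDivisor M → ∀ vQ : (thetaIndex X).VQ, Set ((logShellsDH X logv).Packet j.1 vQ))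
  (col : ℤ → Column (logShellsDH X logv)) (n : ℤ) (p : ℕ)

/-- **At every label over a FREE prime with a tamely ramified place: a STAR-TRIVIAL (Ind2)-generator of the Dupuy–Hilado real shells
MOVES the `q`-image `e⁻¹(𝒪_L)` of the honest setting.** [cite: DupuyHilado2025, §4.9] [cite: WeilBNT1967, Ch. II §2, Th. 2] -/
theorem exists_ind2_starTrivial_moves_qRegion (pp : Nat.Primes) (hp2 : 2 < (pp : ℕ))
    (hfree : ∀ w : (thetaIndex X).V, w ∈ (thetaIndex X).Vbad → (thetaIndex X).over w ≠ .inr pp)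
    (v₀ : HeightOneSpectrum (𝓞 F)) (hv₀ : (thetaIndex X).over (.inr v₀) = .inr pp)
    (he2 : 2 ≤ v₀.asIdeal.ramificationIdx ℤ) (he : v₀.asIdeal.ramificationIdx ℤ ≤ (pp : ℕ) - 2) (j : (thetaIndex X).Label) :
    ∃ Φ ∈ (logShellsDH X logv).Ind2Family,
      (∀ (w : (thetaIndex X).V), w ∈ (thetaIndex X).Vbad → (logShellsDH X logv).starAut Φ w = LinearEquiv.refl ℚ _) ∧
      Φ j (.inr pp) '' (honestSetting X hlog stripAutDH (ismDH logv) refl_mem_stripAutDH (refl_mem_ismDH logv) M archPk archSub Ψ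
          act Mmod region col n p).qRegion j (.inr pp) ≠
        (honestSetting X hlog stripAutDH (ismDH logv) refl_mem_stripAutDH (refl_mem_ismDH logv) M archPk archSub Ψ act Mmod
          region col n p).qRegion j (.inr pp) := by
  classical
  haveI hpF : Fact (pp : ℕ).Prime := ⟨pp.2⟩
  let L := logShellsDH X logv
  set x₀ : (thetaIndex X).Fibre (.inr pp) := ⟨.inr v₀, hv₀⟩ with hx₀def
  set P := presAt X hlog pp
  have hv : ((pp : ℕ) : 𝓞 F) ∈ v₀.asIdeal := natCast_mem_placeOf X pp x₀
  -- §a. a TAME MOVER of `𝒪_{v₀}` in Dupuy–Hilado's (Ind2)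
  obtain ⟨ϖ, hϖ, -⟩ := exists_isUniformizer_rescaledCompletion F pp v₀ hv
  have hjd : ¬ ((v₀.asIdeal.ramificationIdx ℤ : ℕ) : ℤ) ∣ ((0 : ℤ) - 1) := by
    intro hd
    rw [zero_sub, dvd_neg] at hd
    have h1 := Int.eq_one_of_dvd_one (by positivity) hd
    omega
  obtain ⟨g, hg, hmov⟩ := exists_mem_ismDH_image_closedBall_ne_of_tame (hlog pp) hp2 he hϖ (t := 1) (j := 0)
    (by rw [norm_one, zpow_zero]) hjd
  let Bc : Set (Carrier (.inr v₀ : Place F)) := {z | ‖toR (pp : ℕ) v₀ hv z‖ ≤ 1}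
  have hmem_Bc : ∀ z : Carrier (.inr v₀ : Place F), z ∈ Bc ↔ ‖toR (pp : ℕ) v₀ hv z‖ ≤ 1 := fun z => Iff.rfl
  have hgBc : ⇑g '' Bc ≠ Bc := by
    intro h
    apply hmov
    rw [norm_one]
    have hBc2 : (closedBall (0 : RescaledCompletion F (pp : ℕ) v₀ hv) 1) = Bc := by
      ext a
      rw [mem_closedBall_zero_iff]
      exact Iff.rfl
    rw [hBc2]
    exact h
  -- §b. the generator: in tensor slot `0`, `g` at `v₀` and the identity at the other places; identity in the other slots
  let gPl : ∀ y : Place F, Carrier y ≃ₗ[ℚ] Carrier y := fun y =>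
    if h : y = .inr v₀ then (by subst h; exact g) else LinearEquiv.refl ℚ (Carrier y)
  have hgPl_v₀ : gPl (.inr v₀) = g := by
    show (if h : (Sum.inr v₀ : Place F) = .inr v₀ then _ else _) = g
    rw [dif_pos rfl]
  have hgPl_ne : ∀ y : Place F, y ≠ .inr v₀ → gPl y = LinearEquiv.refl ℚ (Carrier y) := by
    intro y hy
    show (if h : y = .inr v₀ then _ else _) = _
    rw [dif_neg hy]
  have hgPl_mem : ∀ y : Place F, gPl y ∈ ismDH logv y := by
    intro y
    by_cases hy : y = .inr v₀
    · subst hy; rw [hgPl_v₀]; exact hg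
    · rw [hgPl_ne y hy]; exact refl_mem_ismDH _ y
  let gA : ∀ (j' : (thetaIndex X).Label) (vQ : (thetaIndex X).VQ), (thetaIndex X).Caps j' →
      ∀ v : (thetaIndex X).Fibre vQ, L.carrier v.1 ≃ₗ[ℚ] L.carrier v.1 := fun j' vQ a v =>
    if a = 0 then gPl v.1 else LinearEquiv.refl ℚ _
  have hgA_mem : ∀ j' vQ a (v : (thetaIndex X).Fibre vQ), gA j' vQ a v ∈ L.ism v.1 := by
    intro j' vQ a v
    by_cases ha : a = 0
    · simp only [gA, if_pos ha]; exact hgPl_mem v.1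
    · simp only [gA, if_neg ha]; exact refl_mem_ismDH _ v.1
  let Φ₀ : L.PacketAut := fun j' vQ => L.factorwise j' vQ fun a => L.summandwise vQ (gA j' vQ a)
  have hΦ₀ : Φ₀ ∈ L.Ind2Family := fun j' vQ => ⟨gA j' vQ, hgA_mem j' vQ, rfl⟩
  -- over a rational prime OTHER than `p₀` every component is the identity (no place there is `v₀`)
  have hΦ₀_ne : ∀ (j' : (thetaIndex X).Label) (vQ : (thetaIndex X).VQ), vQ ≠ .inr pp → Φ₀ j' vQ = LinearEquiv.refl ℚ _ := by
    intro j' vQ hvQ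
    have hfam : (fun a => L.summandwise vQ (gA j' vQ a)) = fun _ => LinearEquiv.refl ℚ (L.Packet1 vQ) := by
      funext a
      have hga : gA j' vQ a = fun v : (thetaIndex X).Fibre vQ => LinearEquiv.refl ℚ (L.carrier v.1) := by
        funext v
        by_cases ha : a = 0
        · have hv1 : v.1 ≠ .inr v₀ := fun h => hvQ (by rw [← v.2, h]; exact hv₀)
          simp only [gA, if_pos ha]
          exact hgPl_ne v.1 hv1
        · simp only [gA, if_neg ha]
      rw [hga]
      exact L.summandwise_refl vQ
    show L.factorwise j' vQ (fun a => L.summandwise vQ (gA j' vQ a)) = _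
    rw [hfam, LogShells.factorwise_refl]
  have hid : ∀ (w : (thetaIndex X).V), w ∈ (thetaIndex X).Vbad → L.starAut Φ₀ w = LinearEquiv.refl ℚ _ := by
    intro w hw
    refine LinearEquiv.ext fun f => funext fun jj => ?_
    show (Φ₀ jj.1 ((thetaIndex X).over w)) (f jj) = f jj
    rw [hΦ₀_ne jj.1 _ (hfree w hw)]
    rfl
  refine ⟨Φ₀, hΦ₀, hid, ?_⟩
  -- §c. the `q`-image at `(j, p₀)` in the real prime packet: `comparison⁻¹ Π_{v⃗} (R_{v⃗})^∼`
  rw [honestSetting_qRegion, preimage_factorMapDH_hullSet_one X hlog j pp]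
  -- §d. test vectors `z ⊗ u₁ ⊗ ⋯ ⊗ u₁` at `v₀` (`u₁ := φ_{v₀}⁻¹ 1`), `0` at the other places
  let u₁ : Carrier (.inr v₀ : Place F) := (P.φ x₀).symm 1
  have hφu₁ : P.φ x₀ u₁ = 1 := LinearEquiv.apply_symm_apply _ _
  let y : Carrier (.inr v₀ : Place F) → (thetaIndex X).Caps j → L.Packet1 (.inr pp) := fun z a =>
    if a = 0 then Pi.single x₀ z else Pi.single x₀ u₁
  have hy_zero_x₀ : ∀ z, y z 0 x₀ = z := fun z => by simp only [y, if_pos rfl]; exact Pi.single_eq_same _ _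
  have hy_ne0_x₀ : ∀ z (a : (thetaIndex X).Caps j), a ≠ 0 → y z a x₀ = u₁ := fun z a ha => by
    simp only [y, if_neg ha]; exact Pi.single_eq_same _ _
  have hy_ne : ∀ z a (v : (thetaIndex X).Fibre (.inr pp)), v ≠ x₀ → y z a v = 0 := fun z a v hv' => by
    by_cases ha : a = 0
    · simp only [y, if_pos ha]; exact Pi.single_eq_of_ne hv' _
    · simp only [y, if_neg ha]; exact Pi.single_eq_of_ne hv' _
  let xz : Carrier (.inr v₀ : Place F) → L.Packet j (.inr pp) := fun z => L.tprod j (.inr pp) (y z)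
  have hφx₀ : ∀ z : Carrier (.inr v₀ : Place F), ‖P.φ x₀ z‖ = ‖toR (pp : ℕ) v₀ hv z‖ := fun z => rfl
  -- norms of the coordinates of a pure tensor: `‖ψ(⊗_a h_a)_i‖ = ∏_a ‖h_a‖`
  have hnorm : ∀ (ev : (thetaIndex X).Caps j → (thetaIndex X).Fibre (.inr pp)) (h : ∀ a, P.kk ev a) (i : DIdx pp.1 (P.kk ev)),
      ‖dEquiv pp.1 (P.kk ev) (PiTensorProduct.tprod ℚ_[pp] h) i‖ = ∏ a, ‖h a‖ := by
    intro ev h i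
    show ‖dEquiv pp.1 (P.kk ev) (purePacket pp.1 (P.kk ev) h) i‖ = _
    rw [psi_purePacket_apply, norm_prod]
    exact Finset.prod_congr rfl fun a _ => norm_factorEmb _ _ _ _ a i (h a)
  have hall : ∀ z, z ∈ Bc → ∀ a (v : (thetaIndex X).Fibre (.inr pp)), ‖P.φ v (y z a v)‖ ≤ 1 := by
    intro z hz a v
    by_cases hv' : v = x₀
    · subst hv'
      by_cases ha : a = 0
      · subst ha; rw [hy_zero_x₀, hφx₀]; exact hz
      · rw [hy_ne0_x₀ z a ha, hφu₁, norm_one]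
    · rw [hy_ne z a v hv', map_zero, norm_zero]; exact zero_le_one
  have hmem_xz : ∀ z, xz z ∈ P.comparison j ⁻¹' (Set.pi univ fun ev =>
      (normalizedPacket pp.1 (P.kk ev) : Set (P.X ev))) ↔ z ∈ Bc := by
    intro z
    rw [hmem_Bc, Set.mem_preimage, Set.mem_univ_pi]
    constructor
    · intro hmem
      have h0 := hmem (fun _ => x₀)
      rw [show P.comparison j (xz z) (fun _ => x₀) = _ from P.comparison_tprod j (y z) (fun _ => x₀), SetLike.mem_coe,
        IsmDHMover.mem_normalizedPacket_iff_norm_dEquiv_le] at h0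
      obtain ⟨i⟩ := nonempty_dIdx pp.1 (P.kk fun _ : (thetaIndex X).Caps j => x₀)
      have h1 := h0 i
      rw [hnorm, Fintype.prod_eq_single (0 : (thetaIndex X).Caps j) (fun a ha => by
        show ‖P.φ x₀ (y z a x₀)‖ = 1
        rw [hy_ne0_x₀ z a ha, hφu₁, norm_one])] at h1
      have h2 : ‖P.φ x₀ (y z 0 x₀)‖ ≤ 1 := h1
      rw [hy_zero_x₀, hφx₀] at h2
      exact h2
    · intro hz ev
      rw [show P.comparison j (xz z) ev = _ from P.comparison_tprod j (y z) ev, SetLike.mem_coe,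
        IsmDHMover.mem_normalizedPacket_iff_norm_dEquiv_le]
      intro i
      rw [hnorm]
      exact Finset.prod_le_one (fun a _ => norm_nonneg _) fun a _ => hall z hz a (ev a)
  -- §e. the generator acts on the test vectors by `g` (slot `0`, place `v₀`)
  have hΦxz : ∀ z, Φ₀ j (.inr pp) (xz z) = xz (g z) := by
    intro z
    show L.factorwise j (.inr pp) (fun a => L.summandwise (.inr pp) (gA j (.inr pp) a)) (L.tprod j (.inr pp) (y z)) =
      L.tprod j (.inr pp) (y (g z))
    rw [L.factorwise_summandwise_tprod]
    congr 1
    funext a v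
    by_cases ha : a = 0
    · subst ha
      simp only [gA, if_pos rfl]
      by_cases hv' : v = x₀
      · rw [hv', hy_zero_x₀, hy_zero_x₀]
        show gPl (.inr v₀) z = g z
        rw [hgPl_v₀]
      · rw [hy_ne z 0 v hv', hy_ne (g z) 0 v hv', map_zero]
    · simp only [gA, if_neg ha, LinearEquiv.refl_apply]
      by_cases hv' : v = x₀
      · rw [hv', hy_ne0_x₀ z a ha, hy_ne0_x₀ (g z) a ha]
      · rw [hy_ne z a v hv', hy_ne (g z) a v hv']
  -- §f. conclusion
  intro hEq
  have key : ∀ x, x ∈ _ ↔ Φ₀ j (.inr pp) x ∈ _ := fun x =>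
    ((Φ₀ j (.inr pp)).injective.mem_set_image).symm.trans (Set.ext_iff.mp hEq (Φ₀ j (.inr pp) x))
  rcases IsmDHMover.exists_of_image_ne g.toEquiv hgBc with ⟨z, hz, hgz⟩ | ⟨z, hz, hgz⟩
  · have h1 : Φ₀ j (.inr pp) (xz z) ∈ _ := (key (xz z)).mp ((hmem_xz z).mpr hz)
    have h2 := (hΦxz z) ▸ h1
    exact hgz ((hmem_xz (g z)).mp h2)
  · have h1 : xz (g z) ∈ _ := (hmem_xz (g z)).mpr hgz
    have h2 := (hΦxz z).symm ▸ h1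
    exact hz ((hmem_xz z).mp ((key (xz z)).mpr h2))

/-- **`not_pinnedRegions_honestSetting_DH_free` — the FREE-PRIME, LABEL-ROBUST refutation of the (hρ)-equivariant pin** at the
honest setting over the Dupuy–Hilado binders: a prime `p₀` with NO bad place above it and a TAMELY RAMIFIED `v₀ | p₀` ⟹
`∀ ρ qK, ¬ PinnedRegions`, by a witness at ANY prescribed label `j` (so also for the (hρ)-half restricted to `j ∈ 𝔽_l^⋇`).
Located, not adjudicated. [claim: Mochizuki2012, status: disputed] [cite: DupuyHilado2025, §4.9] -/
theorem not_pinnedRegions_honestSetting_DH_free (pp : Nat.Primes) (hp2 : 2 < (pp : ℕ))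
    (hfree : ∀ w : (thetaIndex X).V, w ∈ (thetaIndex X).Vbad → (thetaIndex X).over w ≠ .inr pp)
    (v₀ : HeightOneSpectrum (𝓞 F)) (hv₀ : (thetaIndex X).over (.inr v₀) = .inr pp)
    (he2 : 2 ≤ v₀.asIdeal.ramificationIdx ℤ) (he : v₀.asIdeal.ramificationIdx ℤ ≤ (pp : ℕ) - 2) (j : (thetaIndex X).Label)
    (ρ : (∀ v : (thetaIndex X).V, v ∈ (thetaIndex X).Vbad → Set ((logShellsDH X logv).StarPacket v)) →
      ∀ (j : (thetaIndex X).Label) (vQ : (thetaIndex X).VQ), Set ((logShellsDH X logv).Packet j vQ))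
    (qK : ∀ v : (thetaIndex X).V, v ∈ (thetaIndex X).Vbad → Set ((logShellsDH X logv).StarPacket v))
    (hpin : PinnedRegions (latticeSituationReal X hlog stripAutDH (ismDH logv) refl_mem_stripAutDH (refl_mem_ismDH logv) M archPk
        archSub Ψ act Mmod region col)
      (honestSetting X hlog stripAutDH (ismDH logv) refl_mem_stripAutDH (refl_mem_ismDH logv) M archPk archSub Ψ act Mmod
        region col n p) ρ qK) :
    False := by
  obtain ⟨Φ, hΦ, hid, hne⟩ := exists_ind2_starTrivial_moves_qRegion X hlog M archPk archSub Ψ act Mmod region col n p pp hp2 hfree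
    v₀ hv₀ he2 he j
  have hstab : (fun v hv => (logShellsDH X logv).starAut Φ v '' qK v hv) = qK :=
    funext fun v => funext fun hv => by rw [hid v hv]; exact Set.image_id' _
  exact hne (qStabiliser_preserves_qRegion_of_pinnedRegions
    (latticeSituationReal X hlog stripAutDH (ismDH logv) refl_mem_stripAutDH (refl_mem_ismDH logv) M archPk archSub Ψ act Mmod
      region col)
    (honestSetting X hlog stripAutDH (ismDH logv) refl_mem_stripAutDH (refl_mem_ismDH logv) M archPk archSub Ψ act Mmod region
      col n p) qK hpin (Subgroup.subset_closure (Or.inr hΦ)) hstab j (.inr pp))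

end Free

end Summit.ABC.IUTFork.Joshi

end
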